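import Summits.BirchSwinnertonDyer.Rank1Residual.GaloisImage.KolyvaginDerivativeLocalImage
import Summits.BirchSwinnertonDyer.Rank1Residual.GaloisImage.KolyvaginDerivativeInertiaLocal
import Summits.BirchSwinnertonDyer.Rank1Residual.GaloisImage.CyclotomicLevelFrobenius
import Literature.NumberTheory.GaloisRepresentations.TateUnramifiedLiftingReductionProofs
import HarnessLib

/-!
# The local degree of a decomposition group in a cyclotomic level, and THEOREM B of row T-DER at
# the bad places over `ℚ` in the prime-to-`p` case — file 4 of row T-DER-BN
# (cell `b2b-bsdres`, team n1011, seat p15 GEN 6; skeleton `cells/n1011/skel/T-DER-BN.md`)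

HONEST FRAMING (cell `b2b-bsdres`, run/shared/lean/b2b/bsd-rank1-residual/, verbatim in every
file): the goal of the cell is to DELETE the COMBINATION-SHAPED residual classes of the
Birch–Swinnerton-Dyer formula for ALL analytic-rank `≤ 1` elliptic curves over `ℚ` — "full BSD
formula for every rank `≤ 1` curve in class `C`" assembled STRICTLY from published theorems — so
that the rank-`≤ 1` remainder becomes exactly the CONSTRUCTION-SHAPED classes, which are TYPED
(missing-input `Prop`s), NOT attempted. This is not "finishing BSD". Team n1011 (N10 / N11, the
additive block X4 ∧ `p = 3`): research route on the CONSTRUCTION-SHAPED class X4; no claim beyond the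
stated classes; nothing is booked. TOOL theorems (no definition, no named fact, no `sorry`).

## What

§1 **The index of a decomposition group in a cyclotomic kernel** (`index_range_inf_rootsOfUnityFixer`):
for a finite place `w` of `ℚ` with `w ∤ n`, the decomposition group
`D_w = res(Γ_{ℚ_w}) ≤ Γ_ℚ` (`absGaloisRestrict ℚ ℚ_w`) meets `Gal(ℚ̄/ℚ(μ_n)) = ker χ_n` in a
subgroup of index `ord(w mod n)`: `χ_n(D_w) = ⟨χ_n(Frob_w)⟩ = ⟨w⟩ ⊂ (ℤ/n)ˣ` (the tree's
`IsNonarchimedeanLocalField.range_eq_zpowers_of_absInertia_le_ker` — every element of `Γ_{ℚ_w}` is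
`Frob^ν · inertia` — with `χ_n` trivial on `I_w` and `χ_n(Frob_w) = w`,
`modNCyclotomicCharacter_of_isArithFrobAtPlace`).  This is the local degree `[ℚ_w(μ_n) : ℚ_w]`.
§2 **THEOREM B at a place of prime-to-`p` local degree, over `ℚ`**
(`Rat.exists_map_red_eq_resSubgroup_range`): for the cyclotomic levels `cyclotomicLevelsRat p S`,
ANY family of classes `c`, a coefficient map `red : T ⟶ T′` of `ℤ_p`-linear representations, a
level `r`, and a class `κ ∈ H¹(ℚ, T′)` with `res_{ℚ(μ_r)} κ = D_r (red_* c_{0,r})` (the `κ_r` of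
F5 `Rat.exists_sigma_existsUnique_res_eq_deriv_tate`): at every finite place `w` with
`w ∤ ∏_{ℓ∈r} ℓ` whose local degree in `ℚ(μ_r)` is prime to `p` —
`hord : ¬ p ∣ [D_w : D_w ∩ Gal(ℚ̄/ℚ(μ_r))]`, by §1 the order of `w` in `(ℤ/∏ℓ)ˣ` — the restriction
`res_{D_w} κ` is `red_*` of a class of `H¹(D_w, T)`: file 3's bottom-layer theorem
`exists_map_red_eq_resSubgroup_of_index` with `a = [D_w : …]⁻¹ ∈ ℤ_pˣ`.  For `T = T_p E`,
`T′ = E[p^k]`-type coefficients this is the local condition `𝓕_can` (`= 𝓛_w`, the image of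
`H¹(ℚ_w, T)`) of Kolyvagin's derivative class at a BAD place `w ∣ N`, `w ∤ rp`, with no
hypothesis on `E` at `w`; the hypothesis `p ∤ ord(w mod ∏ℓ)` holds when the Kolyvagin primes `ℓ`
are chosen with `w` a `p^{v_p(ℓ-1)}`-th power residue mod `ℓ` (a Chebotarev condition of positive
density on top of `ℓ ∈ 𝒫_k`), and in general exactly when no `K_∞`-absorption is needed; the
complementary case is files 2–3 (`cores_eq_of_resLe_eq_deriv`, `exists_map_red_eq_resSubgroup_cores`).

References: K. Rubin, *Euler Systems* (2000), Thm. 4.5.1; B. Mazur, K. Rubin, Mem. AMS 799 (2004),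
Thm. 3.2.4, Def. 3.1.8 (`𝒫` shrinking), App. A; J. Neukirch, *ANT*, Ch. I (10.3), Ch. II (9.6).
-/

noncomputable section

open CategoryTheory Function Finset Polynomial Field IsDedekindDomain
open scoped NumberField Classical
open Literature.NumberTheory.GaloisRepresentations
open Literature.NumberTheory.GaloisRepresentations.IsNonarchimedeanLocalField

universe u v

namespace Summit.BirchSwinnertonDyer.Rank1Residual.GaloisImage

namespace Derivative

/-! ### §0 Transport along a homomorphism into `D` (localisation currency) -/

section Pullback

variable {R : Type v} [CommRing R] [TopologicalSpace R]
variable {G : Type u} [Group G] [TopologicalSpace G] [IsTopologicalGroup G]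
variable {H : Type u} [Group H] [TopologicalSpace H] [IsTopologicalGroup H]
variable {X Y : TopRep.{u} R G}

/-- **From `res_D` to `θ^*`.**  If `res_D κ = red_* z` on a subgroup `D ≤ G` and `θ : H → G` is a
continuous homomorphism with image in `D` (e.g. `θ = absGaloisRestrict K K_w`, `D` its range, the
decomposition group), then the pull-back `θ^* κ ∈ H¹(H, Y)` is `red_*` of a class of `H¹(H, X)`
(namely `θ′^* z` for the corestricted `θ′ : H → D`). [folklore] -/
theorem exists_map_red_eq_map_of_forall_mem (red : X ⟶ Y) (θ : H →ₜ* G) (D : Subgroup G)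
    (hθ : ∀ h, θ h ∈ D) (κ : continuousCohomology 1 Y) (z : continuousCohomology 1 (subgroupRep X D))
    (hz : ContinuousCohomology.map (ContinuousMonoidHom.id D) (X := subgroupRep X D)
      (Y := subgroupRep Y D) ((TopRep.resFunctor D.subtype).map red) 1 z = resSubgroup Y D 1 κ) :
    ∃ z' : continuousCohomology 1 (TopRep.res (θ : H →* G) X),
      ContinuousCohomology.map (ContinuousMonoidHom.id H) (X := TopRep.res (θ : H →* G) X)
        (Y := TopRep.res (θ : H →* G) Y) ((TopRep.resFunctor (θ : H →* G)).map red) 1 z' =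
      ContinuousCohomology.map θ (𝟙 (TopRep.res (θ : H →* G) Y)) 1 κ := by
  let θ' : H →ₜ* D :=
    { toFun := fun h => ⟨θ h, hθ h⟩
      map_one' := Subtype.ext (map_one θ)
      map_mul' := fun a b => Subtype.ext (map_mul θ a b)
      continuous_toFun := θ.continuous_toFun.subtype_mk _ }
  obtain ⟨ζ, rfl⟩ := oneCocycleClass_surjective _ z
  obtain ⟨Φ, rfl⟩ := oneCocycleClass_surjective _ κ
  rw [map_oneCocycleClass, resSubgroup_oneCocycleClass, ← sub_eq_zero, ← oneCocycleClass_sub,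
    oneCocycleClass_eq_zero_iff] at hz
  obtain ⟨w, hw⟩ := hz
  refine ⟨oneCocycleClass _ (contOneCocycles.pullback θ' (X := subgroupRep X D)
    (Y := TopRep.res (θ : H →* G) X) (TopRep.ofHom ⟨ContinuousLinearMap.id R X, fun _ => rfl⟩) ζ), ?_⟩
  rw [map_oneCocycleClass, map_oneCocycleClass, ← sub_eq_zero, ← oneCocycleClass_sub,
    oneCocycleClass_eq_zero_iff]
  exact ⟨w, fun h => hw (θ' h)⟩

end Pullback

/-! ### §1 The index of a decomposition group in `Gal(ℚ̄/ℚ(μ_n))` -/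

section Index

open Rat.HeightOneSpectrum

/-- **`[D_w : D_w ∩ Gal(ℚ̄/ℚ(μ_n))] = ord(w mod n)`** for `w ∤ n`, `D_w = res(Γ_{ℚ_w})` the
decomposition group of the completion: `χ_n(D_w)` is the cyclic group generated by
`χ_n(Frob_w) = w` (`χ_n` is trivial on the inertia group, and `Γ_{ℚ_w}` is topologically generated by
inertia and a Frobenius — `range_eq_zpowers_of_absInertia_le_ker`).  Neukirch, *ANT* II (9.6),
I (10.3): the unramified extension `ℚ_w(μ_n)/ℚ_w` has degree the order of `w` mod `n`. [folklore] -/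
theorem index_range_inf_rootsOfUnityFixer {n : ℕ} [NeZero n] (w : HeightOneSpectrum (𝓞 ℚ))
    (hn : ¬ ((primesEquiv w : Nat.Primes) : ℕ) ∣ n) :
    (((absGaloisRestrict ℚ (w.adicCompletion ℚ)).toMonoidHom.range ⊓ rootsOfUnityFixer ℚ n).subgroupOf
        (absGaloisRestrict ℚ (w.adicCompletion ℚ)).toMonoidHom.range).index =
      orderOf ((((primesEquiv w : Nat.Primes) : ℕ) : ZMod n)) := by
  set L := w.adicCompletion ℚ with hL
  set res := (absGaloisRestrict ℚ L).toMonoidHom with hres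
  set χ := modNCyclotomicCharacter ℚ n with hχ
  -- the subgroup is the kernel of `χ|_{D_w}`
  rw [Subgroup.inf_subgroupOf_left, rootsOfUnityFixer_eq_ker, ← MonoidHom.ker_restrict,
    Subgroup.index_ker, MonoidHom.restrict_range, ← MonoidHom.range_comp]
  -- `χ ∘ res` has open kernel containing the inertia group
  have h𝔓₀ := adicCompletionPrime_mem_primesAbove ℚ w
  haveI := h𝔓₀.1
  obtain ⟨φ, hφ⟩ := exists_isAbsArithFrob_holds L
  have hI : absInertia L ≤ (χ.comp res).ker := fun t ht => by
    rw [MonoidHom.mem_ker, MonoidHom.comp_apply]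
    have hmem : res t ∈ (adicCompletionPrime ℚ w).inertia (absoluteGaloisGroup ℚ) := by
      rw [inertia_adicCompletionPrime_eq_map_absInertia]
      exact Subgroup.mem_map_of_mem _ ht
    exact modNCyclotomicCharacter_eq_one_of_mem_inertia
      (Rat.natCast_not_mem_of_mem_primesAbove_of_not_dvd h𝔓₀ hn) hmem
  have hopen : IsOpen (((χ.comp res).ker : Subgroup (absoluteGaloisGroup L)) :
      Set (absoluteGaloisGroup L)) := by
    have e : (((χ.comp res).ker : Subgroup (absoluteGaloisGroup L)) : Set (absoluteGaloisGroup L)) =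
        res ⁻¹' (rootsOfUnityFixer ℚ n : Set (absoluteGaloisGroup ℚ)) := by
      ext t
      rw [rootsOfUnityFixer_eq_ker, SetLike.mem_coe, MonoidHom.mem_ker, Set.mem_preimage,
        SetLike.mem_coe, MonoidHom.mem_ker, MonoidHom.comp_apply]
    rw [e]
    exact (isOpen_rootsOfUnityFixer ℚ n).preimage (absGaloisRestrict ℚ L).continuous_toFun
  rw [range_eq_zpowers_of_absInertia_le_ker (χ.comp res) hopen hI hφ, Nat.card_zpowers]
  -- `χ (res φ) = w`
  have hFr : IsArithFrobAtPlace ℚ w (res φ) :=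
    ⟨_, h𝔓₀, (isArithFrobAt_absGaloisRestrict_adicCompletionPrime_iff ℚ w
      (by rw [Literature.NumberTheory.Automorphic.residueFieldCard_adicCompletion_eq ℚ w,
        HeightOneSpectrum.residueCard_eq_card_quotient]) φ).2 hφ⟩
  have hval := CyclotomicLevel.Rat.modNCyclotomicCharacter_of_isArithFrobAtPlace hn hFr
  rw [MonoidHom.comp_apply, ← orderOf_units, ← hval]

/-- **`Gal(ℚ̄/ℚ(μ_r)) = Gal(ℚ̄/ℚ(μ_{∏ℓ}))`**: the bottom level of `cyclotomicLevelsRat p S` at a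
level `r` (a finite set of distinct usable primes `ℓ`) is the fixer of the `(∏_{ℓ∈r} ℓ)`-th roots of
unity (Chinese remainder, `rootsOfUnityFixer_mul_eq_inf`). [folklore] -/
theorem cyclotomicLevelsRat_level_bot_eq_rootsOfUnityFixer_prod (p : ℕ) [Fact p.Prime]
    (S : Set (HeightOneSpectrum (𝓞 ℚ))) (r : Finset (HeightOneSpectrum (𝓞 ℚ))) :
    haveI : NeZero (∏ q ∈ r, ((primesEquiv q : Nat.Primes) : ℕ)) :=
      ⟨Finset.prod_ne_zero_iff.mpr fun q _ => (primesEquiv q).2.ne_zero⟩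
    (cyclotomicLevelsRat p S).level ⊥ r =
      rootsOfUnityFixer ℚ (∏ q ∈ r, ((primesEquiv q : Nat.Primes) : ℕ)) := by
  rw [show (⊥ : ℕ) = 0 from rfl, CyclotomicLevel.Rat.cyclotomicLevelsRat_level_zero]
  induction r using Finset.induction_on with
  | empty =>
    simp only [Finset.notMem_empty, not_false_eq_true, iInf_neg, iInf_top, Finset.prod_empty]
    exact (rootsOfUnityFixer_one ℚ).symm
  | insert a s ha ih =>
    haveI : NeZero ((primesEquiv a : Nat.Primes) : ℕ) := ⟨(primesEquiv a).2.ne_zero⟩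
    haveI : NeZero (∏ q ∈ s, ((primesEquiv q : Nat.Primes) : ℕ)) :=
      ⟨Finset.prod_ne_zero_iff.mpr fun q _ => (primesEquiv q).2.ne_zero⟩
    have hcop : ((primesEquiv a : Nat.Primes) : ℕ).Coprime (∏ q ∈ s, ((primesEquiv q : Nat.Primes) : ℕ)) := by
      refine Nat.Coprime.prod_right fun q hq => ?_
      refine (Nat.coprime_primes (primesEquiv a).2 (primesEquiv q).2).mpr fun h => ha ?_
      rwa [show a = q from primesEquiv.injective (Subtype.ext h)]
    rw [Finset.iInf_insert, Finset.prod_insert ha, CyclotomicLevel.rootsOfUnityFixer_mul_eq_inf ℚ hcop, ih]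

/-- **`hdisj` for the cyclotomic levels over `ℚ`**: `Gal(ℚ̄/ℚ(μ_r)) · Gal(ℚ̄/ℚ(μ_{p^i})) = Γ_ℚ`
(`ℚ(μ_r) ∩ ℚ(μ_{p^i}) = ℚ`, coprime conductors): for every `g ∈ Γ_ℚ` there is `u` fixing the
`(∏ℓ)`-th roots of unity with `u⁻¹ g` fixing the `p^i`-th roots of unity — the hypothesis `hdisj` of
file 2's `cores_eq_of_resLe_eq_deriv` (irreducibility of cyclotomic polynomials over `ℚ`, through the
tree's `exists_smul_eq_smul_and_smul_eq_self`). [folklore] -/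
theorem Rat.exists_mem_level_bot_inv_mul_mem_pLevel (p : ℕ) [Fact p.Prime]
    (S : Set (HeightOneSpectrum (𝓞 ℚ))) (r : (cyclotomicLevelsRat p S).Ideals) (i : ℕ)
    (g : absoluteGaloisGroup ℚ) :
    ∃ u : (cyclotomicLevelsRat p S).level ⊥ r.1,
      (u : absoluteGaloisGroup ℚ)⁻¹ * g ∈ (cyclotomicLevelsRat p S).pLevel i := by
  obtain ⟨σ, hσp, hσm⟩ := RootOfUnityAction.exists_smul_eq_smul_and_smul_eq_self (K := ℚ)
    (fun n hn => cyclotomic.irreducible_rat hn) (Fact.out : p.Prime) g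
  have hcop : p.Coprime (∏ q ∈ r.1, ((primesEquiv q : Nat.Primes) : ℕ)) :=
    Nat.Coprime.prod_right fun q hq =>
      (Nat.coprime_primes Fact.out (primesEquiv q).2).mpr fun h =>
        ((mem_cyclotomicLevelsRat_primes_iff p S q).mp (r.2 q hq)).2 h.symm
  have hσ : σ ∈ (cyclotomicLevelsRat p S).level ⊥ r.1 := by
    rw [cyclotomicLevelsRat_level_bot_eq_rootsOfUnityFixer_prod]
    exact fun t ht => hσm _ hcop t ht
  refine ⟨⟨σ, hσ⟩, ?_⟩
  change σ⁻¹ * g ∈ rootsOfUnityFixer ℚ (p ^ i)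
  intro t ht
  rw [mul_smul, inv_smul_eq_iff, hσp i t ht]

end Index

/-! ### §2 THEOREM B at a place of prime-to-`p` local degree -/

section PrimeToP

variable {K : Type u} [Field K] [NumberField K] {ι : Type} [Preorder ι] [OrderBot ι]
variable {p : ℕ} [Fact p.Prime]
variable {M : Type u} [AddCommGroup M] [Module ℤ_[p] M] [TopologicalSpace M] [IsTopologicalAddGroup M]
  [ContinuousSMul ℤ_[p] M]
variable {L : EulerSystemLevels K ι} {T : GaloisRep K ℤ_[p] M}
variable {c : ∀ (i : ι) (r : L.Ideals), H1 T (L.level i r.1)}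
variable {M' : Type u} [AddCommGroup M'] [Module ℤ_[p] M'] [TopologicalSpace M']
  [IsTopologicalAddGroup M'] [ContinuousSMul ℤ_[p] M'] {T' : GaloisRep K ℤ_[p] M'}

/-- A natural number prime to `p` is a unit of `ℤ_p`. [folklore] -/
theorem isUnit_natCast_padicInt_of_not_dvd {e : ℕ} (he : ¬ p ∣ e) : IsUnit ((e : ℕ) : ℤ_[p]) := by
  rw [PadicInt.isUnit_iff]
  by_contra h
  have hlt : ‖((e : ℤ) : ℤ_[p])‖ < 1 := by
    rw [Int.cast_natCast]
    exact lt_of_le_of_ne (PadicInt.norm_le_one _) h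
  rw [PadicInt.norm_int_lt_one_iff_dvd] at hlt
  exact he (Int.natCast_dvd_natCast.mp hlt)

/-- **THEOREM B of row T-DER at a place of prime-to-`p` local degree (`ℤ_p`-coefficients).**
For levels `L` over a number field `K`, ANY family `c`, a coefficient map `red : T ⟶ T′` of
`ℤ_p`-linear representations, a level `r`, and `κ ∈ H¹(K, T′)` with
`res_{K(r)} κ = D_r (red_* c_{⊥,r})` (F4/F5's `κ_r`): for every subgroup `D ≤ Γ_K` whose
intersection with `Gal(K̄/K(r))` has index PRIME TO `p` in `D` (`hord`; for the decomposition group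
`D = D_w` of a place `w ∉ r` this index is the residue degree of `w` in `K(r)`, over `ℚ` the order
of `w` mod `∏ ℓ` — `index_range_inf_rootsOfUnityFixer`), `res_D κ = red_* z` for some
`z ∈ H¹(D, T)`.  File 3's `exists_map_red_eq_resSubgroup_of_index` with `a = [D : D ∩ Gal(K̄/K(r))]⁻¹ ∈ ℤ_pˣ`.
[cite: Rubin2000, Thm. 4.5.1] [cite: MazurRubin2004, Thm. 3.2.4 and App. A Prop. A.2] -/
theorem exists_map_red_eq_resSubgroup_of_not_dvd_index (red : T.toTopRep ⟶ T'.toTopRep)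
    (r : L.Ideals) (σ : HeightOneSpectrum (𝓞 K) → absoluteGaloisGroup K)
    (N : HeightOneSpectrum (𝓞 K) → ℕ) (comm) (κ : continuousCohomology 1 T'.toTopRep)
    (hκ : resSubgroup T'.toTopRep (L.level ⊥ r.1) 1 κ =
        (r.1.noncommProd (fun ℓ => ∑ j ∈ range (N ℓ), (j : Module.End ℤ_[p] (continuousCohomology 1
          (subgroupRep T'.toTopRep (L.level ⊥ r.1)))) *
          (conjMap T'.toTopRep (L.level ⊥ r.1) (σ ℓ) 1).hom.toLinearMap ^ j) comm)
        (ContinuousCohomology.map (ContinuousMonoidHom.id _) (X := subgroupRep T.toTopRep (L.level ⊥ r.1))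
          (Y := subgroupRep T'.toTopRep (L.level ⊥ r.1))
          ((TopRep.resFunctor (L.level ⊥ r.1).subtype).map red) 1 (c ⊥ r)))
    (D : Subgroup (absoluteGaloisGroup K)) [Fintype (D ⧸ (D ⊓ L.level ⊥ r.1).subgroupOf D)]
    (hord : ¬ p ∣ ((D ⊓ L.level ⊥ r.1).subgroupOf D).index) :
    ∃ z : continuousCohomology 1 (subgroupRep T.toTopRep D),
      ContinuousCohomology.map (ContinuousMonoidHom.id D) (X := subgroupRep T.toTopRep D)
        (Y := subgroupRep T'.toTopRep D) ((TopRep.resFunctor D.subtype).map red) 1 z =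
      resSubgroup T'.toTopRep D 1 κ := by
  have hu := isUnit_natCast_padicInt_of_not_dvd hord
  exact exists_map_red_eq_resSubgroup_of_index red r σ N comm κ hκ D (↑hu.unit⁻¹ : ℤ_[p])
    (fun v => by rw [IsUnit.val_inv_mul, one_smul])

end PrimeToP

/-! ### §3 Over `ℚ`: the localisation of `κ_r` at a place of prime-to-`p` degree in `ℚ(μ_r)` -/

section RatEnd

open Rat.HeightOneSpectrum

variable {p : ℕ} [Fact p.Prime] {S : Set (HeightOneSpectrum (𝓞 ℚ))}
variable {M : Type} [AddCommGroup M] [Module ℤ_[p] M] [TopologicalSpace M] [IsTopologicalAddGroup M]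
  [ContinuousSMul ℤ_[p] M] {T : GaloisRep ℚ ℤ_[p] M}
variable {c : ∀ (i : ℕ) (r : (cyclotomicLevelsRat p S).Ideals), H1 T ((cyclotomicLevelsRat p S).level i r.1)}
variable {M' : Type} [AddCommGroup M'] [Module ℤ_[p] M'] [TopologicalSpace M']
  [IsTopologicalAddGroup M'] [ContinuousSMul ℤ_[p] M'] {T' : GaloisRep ℚ ℤ_[p] M'}

/-- **THEOREM B of row T-DER over `ℚ` at a place `w ∉ r` of prime-to-`p` degree in `ℚ(μ_r)`.**
For the cyclotomic levels `cyclotomicLevelsRat p S`, ANY family `c` of classes (e.g. Kato's), a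
coefficient map `red : T ⟶ T′` of `ℤ_p`-linear representations of `Γ_ℚ`, a level `r`,
Kolyvagin's operator `D_r` for chosen `σ_ℓ, N_ℓ`, and `κ ∈ H¹(ℚ, T′)` with
`res_{ℚ(μ_r)} κ = D_r (red_* c_{0,r})` (the `κ_r` of F5 `Rat.exists_sigma_existsUnique_res_eq_deriv_tate`):
at every finite place `w ∉ r` with **`p ∤ ord(w mod ∏_{ℓ∈r} ℓ)`** (`hord`; = the degree
`[ℚ_w(μ_r) : ℚ_w]`), the localisation `res_w^* κ ∈ H¹(ℚ_w, T′)` is `red_*` of a class of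
`H¹(ℚ_w, T)` — the local condition `𝓕_can` (`= 𝓛_w`) at `w`, with NO hypothesis on `T` at `w`
(bad places `w ∣ N` of an elliptic curve included, `w = p` allowed).  `hord` holds for every bad
`w` when the Kolyvagin primes `ℓ` are taken with `w` a `p^{v_p(ℓ-1)}`-th power residue mod `ℓ`.
[cite: Rubin2000, Thm. 4.5.1] [cite: MazurRubin2004, Thm. 3.2.4 and App. A Prop. A.2] -/
theorem Rat.exists_map_red_eq_localization_of_not_dvd_orderOf (red : T.toTopRep ⟶ T'.toTopRep)
    (r : (cyclotomicLevelsRat p S).Ideals) (σ : HeightOneSpectrum (𝓞 ℚ) → absoluteGaloisGroup ℚ)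
    (N : HeightOneSpectrum (𝓞 ℚ) → ℕ) (comm) (κ : continuousCohomology 1 T'.toTopRep)
    (hκ : resSubgroup T'.toTopRep ((cyclotomicLevelsRat p S).level ⊥ r.1) 1 κ =
        (r.1.noncommProd (fun ℓ => ∑ j ∈ range (N ℓ), (j : Module.End ℤ_[p] (continuousCohomology 1
          (subgroupRep T'.toTopRep ((cyclotomicLevelsRat p S).level ⊥ r.1)))) *
          (conjMap T'.toTopRep ((cyclotomicLevelsRat p S).level ⊥ r.1) (σ ℓ) 1).hom.toLinearMap ^ j) comm)
        (ContinuousCohomology.map (ContinuousMonoidHom.id _)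
          (X := subgroupRep T.toTopRep ((cyclotomicLevelsRat p S).level ⊥ r.1))
          (Y := subgroupRep T'.toTopRep ((cyclotomicLevelsRat p S).level ⊥ r.1))
          ((TopRep.resFunctor ((cyclotomicLevelsRat p S).level ⊥ r.1).subtype).map red) 1 (c ⊥ r)))
    (w : HeightOneSpectrum (𝓞 ℚ)) (hw : ∀ q ∈ r.1, q ≠ w)
    (hord : ¬ p ∣ orderOf ((((primesEquiv w : Nat.Primes) : ℕ) :
      ZMod (∏ q ∈ r.1, ((primesEquiv q : Nat.Primes) : ℕ))))) :
    ∃ z' : continuousCohomology 1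
        (TopRep.res (absGaloisRestrict ℚ (w.adicCompletion ℚ)).toMonoidHom T.toTopRep),
      ContinuousCohomology.map (ContinuousMonoidHom.id (absoluteGaloisGroup (w.adicCompletion ℚ)))
        (X := TopRep.res (absGaloisRestrict ℚ (w.adicCompletion ℚ)).toMonoidHom T.toTopRep)
        (Y := TopRep.res (absGaloisRestrict ℚ (w.adicCompletion ℚ)).toMonoidHom T'.toTopRep)
        ((TopRep.resFunctor (absGaloisRestrict ℚ (w.adicCompletion ℚ)).toMonoidHom).map red) 1 z' =
      ContinuousCohomology.map (absGaloisRestrict ℚ (w.adicCompletion ℚ))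
        (𝟙 (TopRep.res (absGaloisRestrict ℚ (w.adicCompletion ℚ)).toMonoidHom T'.toTopRep)) 1 κ := by
  classical
  set m : ℕ := ∏ q ∈ r.1, ((primesEquiv q : Nat.Primes) : ℕ) with hm
  haveI : NeZero m := ⟨Finset.prod_ne_zero_iff.mpr fun q _ => (primesEquiv q).2.ne_zero⟩
  have hwm : ¬ ((primesEquiv w : Nat.Primes) : ℕ) ∣ m := by
    intro h
    obtain ⟨q, hq, hdvd⟩ := ((primesEquiv w).2.prime.dvd_finsetProd_iff _).mp h
    have heq : ((primesEquiv w : Nat.Primes) : ℕ) = primesEquiv q :=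
      (Nat.prime_dvd_prime_iff_eq (primesEquiv w).2 (primesEquiv q).2).mp hdvd
    exact hw q hq (primesEquiv.injective (Subtype.ext heq.symm))
  set D : Subgroup (absoluteGaloisGroup ℚ) :=
    (absGaloisRestrict ℚ (w.adicCompletion ℚ)).toMonoidHom.range with hD
  have hlev : (cyclotomicLevelsRat p S).level ⊥ r.1 = rootsOfUnityFixer ℚ m :=
    cyclotomicLevelsRat_level_bot_eq_rootsOfUnityFixer_prod p S r.1
  have hidx : ((D ⊓ (cyclotomicLevelsRat p S).level ⊥ r.1).subgroupOf D).index =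
      orderOf ((((primesEquiv w : Nat.Primes) : ℕ) : ZMod m)) := by
    rw [hlev]
    exact index_range_inf_rootsOfUnityFixer w hwm
  have hcop : ((primesEquiv w : Nat.Primes) : ℕ).Coprime m :=
    (Nat.Prime.coprime_iff_not_dvd (primesEquiv w).2).mpr hwm
  have hpos : 0 < orderOf ((((primesEquiv w : Nat.Primes) : ℕ) : ZMod m)) := by
    rw [← ZMod.coe_unitOfCoprime _ hcop, orderOf_units]
    exact orderOf_pos _
  haveI : ((D ⊓ (cyclotomicLevelsRat p S).level ⊥ r.1).subgroupOf D).FiniteIndex :=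
    ⟨by rw [hidx]; exact hpos.ne'⟩
  haveI : Fintype (D ⧸ (D ⊓ (cyclotomicLevelsRat p S).level ⊥ r.1).subgroupOf D) := Fintype.ofFinite _
  have hord' : ¬ p ∣ ((D ⊓ (cyclotomicLevelsRat p S).level ⊥ r.1).subgroupOf D).index := by
    rwa [hidx]
  obtain ⟨z, hz⟩ := exists_map_red_eq_resSubgroup_of_not_dvd_index red r σ N comm κ hκ D hord'
  exact exists_map_red_eq_map_of_forall_mem red (absGaloisRestrict ℚ (w.adicCompletion ℚ)) D
    (fun h => ⟨h, rfl⟩) κ z hz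

end RatEnd

end Derivative

end Summit.BirchSwinnertonDyer.Rank1Residual.GaloisImage

end
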